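/-
Copyright: lit-balaban Phase-2 proof seat p08 (gen 9).  Statement-level skeleton of a published paper; no proof claims beyond what
the kernel checks below.
-/
import Literature.MathematicalPhysics.QuantumFieldTheory.BalabanImbrieJaffe1984to88.BIJ88CurlyDkLocDecayTorus

/-!
# `BalabanImbrieJaffe1984to88.BIJ88CurlyDkLocGradTerm` — T. Bałaban, J. Imbrie, A. Jaffe, *Effective action and cluster properties of
the abelian Higgs model*, Commun. Math. Phys. **114** (1988) 257–315 [BalabanImbrieJaffe1988], Sect. 2 p. 261 [PDF 5]: the clause
**«and similarly for derivatives of 𝒟_{k,loc}»** of (2.13) FOR THE CONCRETE TORUS OBJECT OF RECORD (r18's `dkLocKer`) — PART 1, THE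
SCALE-`j` TERM: the Lipschitz bound of p13's smooth cutoff profile (2.1), the `η`-difference of the localized minimizer
`H_{j,loc} = ζ_jH_j` (product rule: gradient member of [I] (7.2.2) + cutoff slope × sup member), and the scale-`j` term of the
`η`-difference of (2.12) (file 1 of 2; file 2 = `BIJ88CurlyDkLocGradTorus`: the multiscale sum and the assembly from [6I] Prop. 1.2).

statement-level skeleton of published theorems with citation tags; proofs where landed; nothing here is a claim about the Yang–Mills mass gap

PDF held: `paper:balaban1988-cmp114-bij-abelian-higgs-effective-action` (journal page = PDF page + 256), pp. 260–261 [PDF 4–5] (text layer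
re-read this session); [I] = [BalabanImbrieJaffe1985] p. 325 [PDF 27] (7.2.2).

CITATION HEADER (lean-in-tree rule).  Part of the lit-balaban TYPED SKELETON (HOME `run/shared/lean/pub/lit-balaban/`), Phase-2 proof
seat p08 (gen 9), unit `lit-balaban-p08`; free-target protocol G.5-34(d), TAKING line HOME/STATUS.md 2026-08-21T21:42:28Z.  WHAT IS
REPRODUCED = SKELETON row **C2.Eq2.13** (owner r18, referee ref-5), the DERIVATIVE clause *"and similarly for derivatives of 𝒟_{k,loc}"*,
kind «model instance» for r18's (2.12) `dkLocKer` — the per-scale estimate; companion of this seat's `BIJ88CurlyDkLocDecayTorus` (kernel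
decay) and of p08 g8's `BIJ85CurlyDkGradTorus` (the same for the unlocalized `𝒟_k`), whose architecture is repeated with the cutoff's
product rule added.  Decls used BY NAME (nothing restated): r18's `hlKer`/`hKer`/`hdist`/`clKer`/`termKer`/`hlKer_apply`/`abs_hlKer_le`;
p13's `BIJ88Cutoffs21.cutoff`/`cutoffProfile`/`cutoff_apply`/`cutoff_nonneg`/`cutoff_le_one`; file 1's `abs_clKer_ambient_le`,
`abs_hlKer_le_of_sup`; gen 7's `ofLp_HkE_single`, `triple_sum_le`; p09's `distEU`/`ctr`/`supDist_triangle`/`supDist_runSite_le`;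
Mathlib's `Real.smoothTransition` (C¹ ⟹ Lipschitz on `[0,1]` by the mean value theorem).

THE PRINTED TEXT (pp. 260–261, verbatim): *"Let ζ_k(b,b′) be a cutoff function, defined for b ∈ T_η, b′ ∈ T^{(k)}_1, that is
translation invariant and satisfies ζ_k(b,b′) = 0, if dist(b,b′) ≧ ⅛r(e_k), 1, if dist(b,b′) ≦ (1/16)r(e_k), (2.1) and such that ζ_k
is a smooth function of b. … Thus |(𝒟_{k,loc}f)(b)| ≦ ce^{−c dist(suppt f,b)}‖f‖_∞ (2.13) and similarly for derivatives of 𝒟_{k,loc}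
and Hölder derivatives of order less than 2."*  Mechanism formalized (the print gives none beyond *"derives its regularity and decay
from that of C^{(j)}_{loc} and H_{k,loc}"*): the `η`-lattice difference of `H_{j,loc}(b,b₁) = ζ_j(b,b₁)H_j(b,b₁)` in `b` is
`ζ_j(b+ηe_λ,b₁)·Δ_λH_j(b,b₁) + Δ_λζ_j(b,b₁)·H_j(b,b₁)`; the first term is the gradient member of (7.2.2) (`≤ L^{−j}Me^{−δ dist}`), the second
the slope of the smooth profile across the annulus `r/16 ≤ dist ≤ r/8` (width `r/16` in units of `T₁^{(j)}`, one `η`-step = `L^{−j}` unit)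
times the sup member: `≤ (16C_σ/r)L^{−j}Me^{−δ dist}`.

WHAT IS PROVED (0 `sorry`, standard axioms; theorems only — proof lane; every `d ≥ 2`):
* §1 THE CUTOFF SLOPE: `exists_cutoffProfile_lipschitz` (`∃ C_σ ≥ 0 ∀ R₁ < R₀ ∀ t s, |σ_{R₁,R₀}(t) − σ_{R₁,R₀}(s)| ≤ C_σ/(R₀ − R₁)·|t − s|`,
  `C_σ` a Lipschitz constant of `Real.smoothTransition`), `abs_distEU_shift_sub_le` (one `η`-step moves the (7.2.2) distance by
  `≤ L^{−j}`), `abs_cutoff_shift_sub_le` (`|ζ(b+ηe_λ,b₁) − ζ(b,b₁)| ≤ C_σ/(R₀ − R₁)·L^{−j}`).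
* §2 **`abs_hlKer_shift_sub_le`**: `|H_{j,loc}(⟨x+e_λ,μ⟩,b₁) − H_{j,loc}(⟨x,μ⟩,b₁)| ≤ L^{−j}·M(1 + C_σ/(R₀ − R₁))·e^{−δ dist(x,b₁)}` from the sup
  and gradient members of (7.2.2) (product rule above).
* §3 `abs_triple_le₂` (file 1's kernel-generic `abs_triple_le` with two different outer kernels `h`, `h′`), `termKer_shift_sub_eq_sum`,
  **`abs_gradTermLoc_le`**: the scale-`j` term of `𝒟_{k,loc}(⟨x+e_λ,μ⟩,b″) − 𝒟_{k,loc}(⟨x,μ⟩,b″)` at the weights of step `k` is at most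
  `L^{−j}·(1 + 16C_σ/ρ_j)·M²M_C(L^{k−j})^{d−2}d²e^{a/2}K(a)²·e^{−a|x−b″₋|_∞/L^j}`, `a = min(δ,δ_C)/2` — one factor `L^{−j}` better than the kernel's
  term, as for `𝒟_k`.
HONEST SCOPE.  (i) Per-scale estimate only; the multiscale sum, the assembly from `B5.Prop12Printed` and the quantifier bookkeeping are
file 2.  (ii) The derivative is the forward `η`-lattice difference in the FIRST (output) argument, as in p08 g8's `BIJ85CurlyDkGradTorus`;
the Hölder clause is not treated.  (iii) The cutoff slope constant `C_σ` is existential (a Lipschitz constant of Mathlib's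
`Real.smoothTransition`, obtained by compactness — no numerical value); the dependence on the radius is the explicit `1/(R₀ − R₁) = 16/ρ_j`,
so uniformity in `k` needs the radii bounded below (`ρ_j ≥ ρ₀ > 0`; print: `r(e_k) → ∞`).  (iv) `U = 1`, real abelian fields, torus,
standing range.  (v) No `def`, no new named fact, nothing restated; NOT summit progress.  Unit `lit-balaban-p08`
(literature-prover-lit-balaban-p08-g9-0), 2026-08-21.
-/

open scoped BigOperators RealInnerProductSpace

namespace Literature.MathematicalPhysics.QuantumFieldTheory.BalabanImbrieJaffe1984to88.BIJ88CurlyDkLocGradTerm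

open Balaban1983to89 hiding Site Plaq
open Balaban1983to89.LatticeFieldCalculus
open BIJ88Ineq217Ineq722Torus (ofLp_HkE_single)
open BIJ88Decay216Torus (triple_sum_le)
open B3TorusRadialSums (supDist_comm)
open BIJ85Prop521Torus BIJ85Prop522Torus BIJ85Sigma422Eta
open BIJ85Sect7Statements BIJ85Ineq722Torus
open BIJ85Ineq722DeltaA (deltaAData)
open BIJ88ClocEstimatesTorus (Cloc)
open BIJ88Cutoffs21 (cutoff cutoffProfile cutoff_apply cutoff_nonneg cutoff_le_one)
open BIJ88CurlyDkLocTorus BIJ88CurlyDkLocDecayTorus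
-- inside this namespace the bare `Site`/`Plaq` are the `ℤ^d` carriers of the QFT root; the torus ones are renamed:
open Balaban1983to89 renaming Site → TSite, Plaq → TPlaq

noncomputable section

variable {P : Params}

/-! ## §1  The slope of the smooth cutoff (2.1) -/

/-- Mathlib's smooth transition `σ` is globally Lipschitz: it is `C¹`, hence Lipschitz on the compact interval `[0,1]` with the bound of
its derivative there (mean value theorem), and it is constant outside `[0,1]`, so the clamp `t ↦ max 0 (min 1 t)` reduces every pair of
points to that interval. [folklore] -/
private theorem exists_lipschitz_smoothTransition :
    ∃ C : ℝ, 0 ≤ C ∧ ∀ t s : ℝ, |Real.smoothTransition t - Real.smoothTransition s| ≤ C * |t - s| := by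
  have hcd : ContDiff ℝ 1 Real.smoothTransition := Real.smoothTransition.contDiff
  have hdiff : Differentiable ℝ Real.smoothTransition := hcd.differentiable_one
  have hcont : Continuous (deriv Real.smoothTransition) := hcd.continuous_deriv_one
  obtain ⟨C, hC⟩ := (isCompact_Icc : IsCompact (Set.Icc (0:ℝ) 1)).exists_bound_of_continuousOn hcont.continuousOn
  have hC0 : 0 ≤ C := (norm_nonneg _).trans (hC 0 ⟨le_rfl, zero_le_one⟩)
  refine ⟨C, hC0, fun t s => ?_⟩
  have hclamp : ∀ u : ℝ, Real.smoothTransition u = Real.smoothTransition (max (min u 1) 0) := by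
    intro u
    rcases le_total u 0 with hu | hu
    · rw [min_eq_left (hu.trans zero_le_one), max_eq_right hu, Real.smoothTransition.zero_of_nonpos hu,
        Real.smoothTransition.zero]
    · rcases le_total 1 u with hu1 | hu1
      · rw [min_eq_right hu1, max_eq_left zero_le_one, Real.smoothTransition.one_of_one_le hu1, Real.smoothTransition.one]
      · rw [min_eq_left hu1, max_eq_left hu]
  have hmem : ∀ u : ℝ, max (min u 1) 0 ∈ Set.Icc (0:ℝ) 1 := fun u => ⟨le_max_right _ _, max_le (min_le_right _ _) zero_le_one⟩
  have hdist : |max (min t 1) 0 - max (min s 1) 0| ≤ |t - s| := by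
    refine (abs_max_sub_max_le_abs _ _ _).trans ?_
    refine (abs_min_sub_min_le_max _ _ _ _).trans ?_
    rw [sub_self, abs_zero]
    exact max_le le_rfl (abs_nonneg _)
  have hmvt := (convex_Icc (0:ℝ) 1).norm_image_sub_le_of_norm_deriv_le (fun x _ => hdiff.differentiableAt) (fun x hx => hC x hx)
    (hmem s) (hmem t)
  rw [Real.norm_eq_abs, Real.norm_eq_abs] at hmvt
  rw [hclamp t, hclamp s]
  exact hmvt.trans (mul_le_mul_of_nonneg_left hdist hC0)

/-- **THE SLOPE OF THE CUTOFF PROFILE**: `∃ C_σ ≥ 0` such that for all radii `R₁ < R₀` and all `t, s`,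
`|σ_{R₁,R₀}(t) − σ_{R₁,R₀}(s)| ≤ C_σ/(R₀ − R₁)·|t − s|` for p13's profile `σ_{R₁,R₀}(t) = σ((R₀ − t)/(R₀ − R₁))` of (2.1)/(2.24)/(2.29) —
*"such that ζ_k is a smooth function of b"*: the annulus has width `R₀ − R₁`. [cite: BalabanImbrieJaffe1988, (2.1) p.260] -/
theorem exists_cutoffProfile_lipschitz :
    ∃ C : ℝ, 0 ≤ C ∧ ∀ (R₁ R₀ : ℝ), R₁ < R₀ → ∀ t s : ℝ,
      |cutoffProfile R₁ R₀ t - cutoffProfile R₁ R₀ s| ≤ C / (R₀ - R₁) * |t - s| := by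
  obtain ⟨C, hC0, hC⟩ := exists_lipschitz_smoothTransition
  refine ⟨C, hC0, fun R₁ R₀ hR t s => ?_⟩
  have hw : 0 < R₀ - R₁ := sub_pos.2 hR
  unfold cutoffProfile
  refine (hC _ _).trans (le_of_eq ?_)
  rw [← sub_div, abs_div, abs_of_pos hw, show R₀ - t - (R₀ - s) = -(t - s) by ring, abs_neg]
  field_simp

/-- `|x − (x + e_μ)|_∞ ≤ 1`. [folklore] -/
private theorem supDist_shift_le {j : ℕ} (x : TSite P j) (μ : Fin P.d) : supDist x (x.shift μ) ≤ 1 := by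
  have h := supDist_runSite_le x μ 1
  have h2 : runSite x μ 1 = x.shift μ := by
    show Function.update x μ (x μ + ((1 : ℕ) : ZMod _)) = Function.update x μ (x μ + 1)
    rw [Nat.cast_one]
  rwa [h2] at h

/-- `0 < L^n`. [folklore] -/
private theorem cast_pow_L_pos' (n : ℕ) : (0 : ℝ) < (P.L : ℝ) ^ n := pow_pos P.cast_L_pos n

/-- **one `η`-step moves the (7.2.2) distance by at most one unit of `T_η`**: `|dist(x + e_λ, y) − dist(x, y)| ≤ L^{−j}` for p09's
`dist(x, y) = |x − y_y|_∞/L^j`. [cite: BalabanImbrieJaffe1985, (7.2.2) p.325] -/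
theorem abs_distEU_shift_sub_le (j : ℕ) (x : TSite P 0) (lam : Fin P.d) (y : TSite P j) :
    |distEU P j (x.shift lam) y - distEU P j x y| ≤ ((P.L : ℝ) ^ j)⁻¹ := by
  have hLj := cast_pow_L_pos' (P := P) j
  unfold distEU
  rw [← sub_div, abs_div, abs_of_pos hLj, div_le_iff₀ hLj, inv_mul_cancel₀ hLj.ne']
  have t1 := supDist_triangle (x.shift lam) x (ctr j y)
  have t2 := supDist_triangle x (x.shift lam) (ctr j y)
  have h1 : supDist (x.shift lam) x ≤ 1 := by rw [supDist_comm]; exact supDist_shift_le x lam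
  have h2 : supDist x (x.shift lam) ≤ 1 := supDist_shift_le x lam
  rw [abs_le]
  constructor
  · have : (supDist x (ctr j y) : ℝ) ≤ (supDist (x.shift lam) (ctr j y) : ℝ) + 1 := by exact_mod_cast t2.trans (by omega)
    linarith
  · have : (supDist (x.shift lam) (ctr j y) : ℝ) ≤ (supDist x (ctr j y) : ℝ) + 1 := by exact_mod_cast t1.trans (by omega)
    linarith

/-- **the slope of `ζ_j` along one `η`-step**: for the torus cutoff `ζ_j(b, b₁) = σ_{R₁,R₀}(dist(b, b₁))` (r18's `hdist`) and a slope constant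
`C_σ` of the profile, `|ζ_j(⟨x+e_λ,μ⟩, b₁) − ζ_j(⟨x,μ⟩, b₁)| ≤ C_σ/(R₀ − R₁)·L^{−j}`. [cite: BalabanImbrieJaffe1988, (2.1) p.260] -/
theorem abs_cutoff_shift_sub_le {C R₁ R₀ : ℝ} (hC0 : 0 ≤ C) (hR : R₁ < R₀)
    (hC : ∀ t s : ℝ, |cutoffProfile R₁ R₀ t - cutoffProfile R₁ R₀ s| ≤ C / (R₀ - R₁) * |t - s|)
    (j : ℕ) (x : TSite P 0) (μ lam : Fin P.d) (b₁ : PBond P j) :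
    |cutoff R₁ R₀ (hdist (P := P) j) ⟨x.shift lam, μ⟩ b₁ - cutoff R₁ R₀ (hdist (P := P) j) ⟨x, μ⟩ b₁| ≤
      C / (R₀ - R₁) * ((P.L : ℝ) ^ j)⁻¹ := by
  have hw : 0 < R₀ - R₁ := sub_pos.2 hR
  show |cutoffProfile R₁ R₀ (hdist (P := P) j ⟨x.shift lam, μ⟩ b₁) - cutoffProfile R₁ R₀ (hdist (P := P) j ⟨x, μ⟩ b₁)| ≤ _
  refine (hC _ _).trans (mul_le_mul_of_nonneg_left ?_ (div_nonneg hC0 hw.le))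
  exact abs_distEU_shift_sub_le j x lam b₁.src

/-! ## §2  The `η`-difference of `H_{j,loc} = ζ_jH_j` -/

/-- **THE PRODUCT RULE FOR `H_{j,loc}`**: with the sup and gradient members of (7.2.2) at scale `j` (`|H_j(x;y)| ≤ Me^{−δ dist}`,
`‖L^j(H_j(x+e_λ;y) − H_j(x;y))‖ ≤ Me^{−δ dist}`) and a slope constant `C_σ` of the cutoff profile (radii `R₁ < R₀`, any weights `w > 0`,
`c ≠ 0`): `|H_{j,loc}(⟨x+e_λ,μ⟩, b₁) − H_{j,loc}(⟨x,μ⟩, b₁)| ≤ L^{−j}·M(1 + C_σ/(R₀ − R₁))·e^{−δ dist(x, b₁)}` —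
`ζ(x+e_λ)Δ_λH + (Δ_λζ)H(x)`, `0 ≤ ζ ≤ 1`. [cite: BalabanImbrieJaffe1988, (2.5) p.260] -/
theorem abs_hlKer_shift_sub_le {j : ℕ} (hj : j ≤ P.m + P.K) {w c : ℝ} (hw : 0 < w) (hc : c ≠ 0) {a : ℝ} (ha : 0 < a)
    {δ M : ℝ}
    (hH : ∀ (μ ν : Fin P.d) (x : TSite P 0) (y : TSite P j),
      |(torusRep P j (deltaAData hj a)).H (x, μ) (y, ν)| ≤ M * Real.exp (-(δ * distEU P j x y)))
    (hB : ∀ (μ ν : Fin P.d) (x : TSite P 0) (y : TSite P j),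
      ‖fun lam : Fin P.d => (P.L : ℝ) ^ j *
          ((torusRep P j (deltaAData hj a)).H (x.shift lam, μ) (y, ν) - (torusRep P j (deltaAData hj a)).H (x, μ) (y, ν))‖ ≤
        M * Real.exp (-(δ * distEU P j x y)))
    {C R₁ R₀ : ℝ} (hC0 : 0 ≤ C) (hR : R₁ < R₀)
    (hCζ : ∀ t s : ℝ, |cutoffProfile R₁ R₀ t - cutoffProfile R₁ R₀ s| ≤ C / (R₀ - R₁) * |t - s|)
    (x : TSite P 0) (μ lam : Fin P.d) (b₁ : PBond P j) :
    |hlKer (P := P) w c R₁ R₀ j ⟨x.shift lam, μ⟩ b₁ - hlKer (P := P) w c R₁ R₀ j ⟨x, μ⟩ b₁| ≤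
      ((P.L : ℝ) ^ j)⁻¹ * (M * (1 + C / (R₀ - R₁))) * Real.exp (-(δ * distEU P j x b₁.src)) := by
  have hLj : 0 < (P.L : ℝ) ^ j := cast_pow_L_pos' j
  have hM : 0 ≤ M := by
    have h := hH ⟨0, P.hd⟩ ⟨0, P.hd⟩ default default
    exact (mul_nonneg_iff_of_pos_right (Real.exp_pos _)).1 ((abs_nonneg _).trans h)
  have hent : ∀ (z : TSite P 0) (κ : Fin P.d), hKer (P := P) w c j ⟨z, κ⟩ b₁ =
      (torusRep P j (deltaAData hj a)).H (z, κ) (b₁.src, b₁.dir) := fun z κ => ofLp_HkE_single hj hc hw ha b₁ z κ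
  -- the two members at the point x
  have hHx : |hKer (P := P) w c j ⟨x, μ⟩ b₁| ≤ M * Real.exp (-(δ * distEU P j x b₁.src)) := by
    rw [hent]; exact hH _ _ _ _
  have hDx : |hKer (P := P) w c j ⟨x.shift lam, μ⟩ b₁ - hKer (P := P) w c j ⟨x, μ⟩ b₁| ≤
      ((P.L : ℝ) ^ j)⁻¹ * M * Real.exp (-(δ * distEU P j x b₁.src)) := by
    rw [hent, hent]
    have h1 := (norm_le_pi_norm (fun lam' : Fin P.d => (P.L : ℝ) ^ j *
      ((torusRep P j (deltaAData hj a)).H (x.shift lam', μ) (b₁.src, b₁.dir) -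
        (torusRep P j (deltaAData hj a)).H (x, μ) (b₁.src, b₁.dir))) lam).trans (hB μ b₁.dir x b₁.src)
    rw [Real.norm_eq_abs, abs_mul, abs_of_pos hLj] at h1
    rw [mul_assoc, le_inv_mul_iff₀ hLj]
    exact h1
  -- the cutoff values and slope
  have hζ1 : |cutoff R₁ R₀ (hdist (P := P) j) ⟨x.shift lam, μ⟩ b₁| ≤ 1 := by
    rw [abs_of_nonneg (cutoff_nonneg _ _ _ _ _)]; exact cutoff_le_one _ _ _ _ _
  have hζD := abs_cutoff_shift_sub_le (P := P) hC0 hR hCζ j x μ lam b₁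
  -- product rule
  rw [hlKer_apply, hlKer_apply]
  have e : cutoff R₁ R₀ (hdist (P := P) j) ⟨x.shift lam, μ⟩ b₁ * hKer w c j ⟨x.shift lam, μ⟩ b₁ -
      cutoff R₁ R₀ (hdist (P := P) j) ⟨x, μ⟩ b₁ * hKer w c j ⟨x, μ⟩ b₁ =
      cutoff R₁ R₀ (hdist (P := P) j) ⟨x.shift lam, μ⟩ b₁ * (hKer w c j ⟨x.shift lam, μ⟩ b₁ - hKer w c j ⟨x, μ⟩ b₁) +
        (cutoff R₁ R₀ (hdist (P := P) j) ⟨x.shift lam, μ⟩ b₁ - cutoff R₁ R₀ (hdist (P := P) j) ⟨x, μ⟩ b₁) * hKer w c j ⟨x, μ⟩ b₁ := by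
    ring
  rw [e]
  refine (abs_add_le _ _).trans ?_
  rw [abs_mul, abs_mul]
  calc |cutoff R₁ R₀ (hdist (P := P) j) ⟨x.shift lam, μ⟩ b₁| * |hKer w c j ⟨x.shift lam, μ⟩ b₁ - hKer w c j ⟨x, μ⟩ b₁| +
        |cutoff R₁ R₀ (hdist (P := P) j) ⟨x.shift lam, μ⟩ b₁ - cutoff R₁ R₀ (hdist (P := P) j) ⟨x, μ⟩ b₁| * |hKer w c j ⟨x, μ⟩ b₁|
      ≤ 1 * (((P.L : ℝ) ^ j)⁻¹ * M * Real.exp (-(δ * distEU P j x b₁.src))) +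
          C / (R₀ - R₁) * ((P.L : ℝ) ^ j)⁻¹ * (M * Real.exp (-(δ * distEU P j x b₁.src))) :=
        add_le_add (mul_le_mul hζ1 hDx (abs_nonneg _) zero_le_one) (mul_le_mul hζD hHx (abs_nonneg _) (by positivity))
    _ = _ := by ring

/-! ## §3  The scale-`j` term of the `η`-difference of (2.12) -/

/-- `Σ_b f(b₋) = d·Σ_y f(y)` on `T^{(j)}`. [folklore] -/
private theorem sum_bond_src {j : ℕ} (f : TSite P j → ℝ) : ∑ b : PBond P j, f b.src = (P.d : ℝ) * ∑ y : TSite P j, f y := by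
  rw [← Fintype.sum_equiv (LatticeFieldCalculus.bondEquiv (P := P) (j := j)) (fun q : TSite P j × Fin P.d => f q.1) _
    (fun q => rfl), Fintype.sum_prod_type]
  simp only [Finset.sum_const, Finset.card_univ, Fintype.card_fin, nsmul_eq_mul]
  rw [Finset.mul_sum]

/-- **file 1's kernel-generic per-scale estimate with two outer kernels** (`j ≤ m + K`): `|h(b,b₁)| ≤ Me^{−δ dist(b,b₁)}`,
`|h′(b″,b₂)| ≤ M′e^{−δ dist(b″,b₂)}`, `|C(b₁,b₂)| ≤ M_Ce^{−δ_C|b₁₋−b₂₋|_∞}` ⟹ `|Σ_{b₁b₂}h(b,b₁)C(b₁,b₂)h′(b″,b₂)| ≤ MM′M_C·d²e^{a/2}K(a)²·e^{−a|b₋−b″₋|_∞/L^j}`,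
`a = min(δ,δ_C)/2` (gen 7's `triple_sum_le`). [cite: BalabanImbrieJaffe1988, (2.12) p.261] -/
theorem abs_triple_le₂ {j : ℕ} (hj : j ≤ P.m + P.K) {δ M M' δC MC : ℝ} (hδ : 0 < δ) (hδC : 0 < δC) (hM : 0 ≤ M) (hM' : 0 ≤ M')
    (hMC : 0 ≤ MC) {h h' : PBond P 0 → PBond P j → ℝ} {C : PBond P j → PBond P j → ℝ}
    (hH : ∀ (b₀ : PBond P 0) (b₁ : PBond P j), |h b₀ b₁| ≤ M * Real.exp (-(δ * distEU P j b₀.src b₁.src)))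
    (hH' : ∀ (b₀ : PBond P 0) (b₁ : PBond P j), |h' b₀ b₁| ≤ M' * Real.exp (-(δ * distEU P j b₀.src b₁.src)))
    (hC : ∀ b₁ b₂ : PBond P j, |C b₁ b₂| ≤ MC * Real.exp (-(δC * (supDist b₁.src b₂.src : ℝ))))
    (b b'' : PBond P 0) :
    |∑ b₁ : PBond P j, ∑ b₂ : PBond P j, h b b₁ * C b₁ b₂ * h' b'' b₂| ≤
      M * M' * MC * (P.d : ℝ) ^ 2 * (Real.exp (min δ δC / 2 / 2) * ((2 * (1 + P.d / (min δ δC / 2))) ^ P.d) ^ 2) *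
        Real.exp (-(min δ δC / 2 * ((supDist b.src b''.src : ℝ) / (P.L : ℝ) ^ j))) := by
  have hpt : ∀ b₁ b₂ : PBond P j, |h b b₁ * C b₁ b₂ * h' b'' b₂| ≤
      M * M' * MC * (Real.exp (-(δ * distEU P j b.src b₁.src)) * Real.exp (-(δC * (supDist b₁.src b₂.src : ℝ))) *
        Real.exp (-(δ * distEU P j b''.src b₂.src))) := by
    intro b₁ b₂
    rw [abs_mul, abs_mul]
    calc _ ≤ (M * Real.exp (-(δ * distEU P j b.src b₁.src))) * (MC * Real.exp (-(δC * (supDist b₁.src b₂.src : ℝ)))) *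
          (M' * Real.exp (-(δ * distEU P j b''.src b₂.src))) :=
          mul_le_mul (mul_le_mul (hH b b₁) (hC b₁ b₂) (abs_nonneg _) (by positivity)) (hH' b'' b₂) (abs_nonneg _) (by positivity)
      _ = _ := by ring
  calc _ ≤ ∑ b₁ : PBond P j, ∑ b₂ : PBond P j, M * M' * MC * (Real.exp (-(δ * distEU P j b.src b₁.src)) *
          Real.exp (-(δC * (supDist b₁.src b₂.src : ℝ))) * Real.exp (-(δ * distEU P j b''.src b₂.src))) :=
        (Finset.abs_sum_le_sum_abs _ _).trans (Finset.sum_le_sum fun b₁ _ =>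
          (Finset.abs_sum_le_sum_abs _ _).trans (Finset.sum_le_sum fun b₂ _ => hpt b₁ b₂))
    _ = M * M' * MC * ((P.d : ℝ) * ∑ y : TSite P j, (P.d : ℝ) * ∑ y' : TSite P j, Real.exp (-(δ * distEU P j b.src y)) *
          Real.exp (-(δC * (supDist y y' : ℝ))) * Real.exp (-(δ * distEU P j b''.src y'))) := by
        rw [← sum_bond_src (fun y => (P.d : ℝ) * ∑ y' : TSite P j, Real.exp (-(δ * distEU P j b.src y)) *
          Real.exp (-(δC * (supDist y y' : ℝ))) * Real.exp (-(δ * distEU P j b''.src y'))), Finset.mul_sum]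
        refine Finset.sum_congr rfl fun b₁ _ => ?_
        rw [← sum_bond_src (fun y' => Real.exp (-(δ * distEU P j b.src b₁.src)) * Real.exp (-(δC * (supDist b₁.src y' : ℝ))) *
          Real.exp (-(δ * distEU P j b''.src y'))), Finset.mul_sum]
    _ = M * M' * MC * (P.d : ℝ) ^ 2 * ∑ y : TSite P j, ∑ y' : TSite P j, Real.exp (-(δ * distEU P j b.src y)) *
          Real.exp (-(δC * (supDist y y' : ℝ))) * Real.exp (-(δ * distEU P j b''.src y')) := by
        rw [← Finset.mul_sum]; ring
    _ ≤ M * M' * MC * (P.d : ℝ) ^ 2 * (Real.exp (min δ δC / 2 / 2) * ((2 * (1 + P.d / (min δ δC / 2))) ^ P.d) ^ 2 *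
          Real.exp (-(min δ δC / 2 * ((supDist b.src b''.src : ℝ) / (P.L : ℝ) ^ j)))) :=
        mul_le_mul_of_nonneg_left (triple_sum_le hj hδ hδC b.src b''.src) (by positivity)
    _ = _ := by ring

/-- the scale-`j` term of the `η`-difference of (2.12): `G^{(j),η}_{loc}(⟨x+e_λ,μ⟩, b″) − G^{(j),η}_{loc}(⟨x,μ⟩, b″) =
Σ_{b₁b₂}(H_{j,loc}(⟨x+e_λ,μ⟩,b₁) − H_{j,loc}(⟨x,μ⟩,b₁))·C^{(j)}_{loc}(b₁,b₂)·H_{j,loc}(b″,b₂)`. [cite: BalabanImbrieJaffe1988, (2.12) p.261] -/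
theorem termKer_shift_sub_eq_sum (w c : ℝ) (ρ : ℕ → ℝ) (j : ℕ) (x : TSite P 0) (μ lam : Fin P.d) (b'' : PBond P 0) :
    termKer (P := P) w c ρ j ⟨x.shift lam, μ⟩ b'' - termKer (P := P) w c ρ j ⟨x, μ⟩ b'' =
      ∑ b₁ : PBond P j, ∑ b₂ : PBond P j,
        (hlKer w c (ρ j / 16) (ρ j / 8) j ⟨x.shift lam, μ⟩ b₁ - hlKer w c (ρ j / 16) (ρ j / 8) j ⟨x, μ⟩ b₁) *
          clKer w c (ρ j / 4) j b₁ b₂ * hlKer w c (ρ j / 16) (ρ j / 8) j b'' b₂ := by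
  unfold termKer
  rw [← Finset.sum_sub_distrib]
  refine Finset.sum_congr rfl fun b₁ _ => ?_
  rw [← Finset.sum_sub_distrib]
  refine Finset.sum_congr rfl fun b₂ _ => ?_
  ring

/-- **THE SCALE-`j` TERM OF THE `η`-DIFFERENCE OF `𝒟_{k,loc}` AT THE WEIGHTS OF STEP `k`** (`j ≤ k`, `j ≤ m + K`, `d ≥ 2`, radius `ρ_j > 0`):
given the sup and gradient members of (7.2.2) for `H_j`, a (2.5)-analogue bound for the `C^{(j)}_{loc}` of record at radius `ρ_j/4` and a
slope constant `C_σ` of the cutoff profile, the term is at most `L^{−j}·(1 + 16C_σ/ρ_j)·M²·M_C(L^{k−j})^{d−2}·d²e^{a/2}K(a)²·e^{−a|x−b″₋|_∞/L^j}`,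
`a = min(δ,δ_C)/2` (annulus width `ρ_j/8 − ρ_j/16 = ρ_j/16`). [cite: BalabanImbrieJaffe1988, (2.13) p.261] -/
theorem abs_gradTermLoc_le (hd : 2 ≤ P.d) {k j : ℕ} (hj : j ≤ P.m + P.K) (hjk : j ≤ k) {a : ℝ} (ha : 0 < a)
    {δ M δC MC : ℝ} (hδ : 0 < δ) (hδC : 0 < δC) (hMC : 0 ≤ MC)
    (hH : ∀ (μ ν : Fin P.d) (x : TSite P 0) (y : TSite P j),
      |(torusRep P j (deltaAData hj a)).H (x, μ) (y, ν)| ≤ M * Real.exp (-(δ * distEU P j x y)))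
    (hB : ∀ (μ ν : Fin P.d) (x : TSite P 0) (y : TSite P j),
      ‖fun lam : Fin P.d => (P.L : ℝ) ^ j *
          ((torusRep P j (deltaAData hj a)).H (x.shift lam, μ) (y, ν) - (torusRep P j (deltaAData hj a)).H (x, μ) (y, ν))‖ ≤
        M * Real.exp (-(δ * distEU P j x y)))
    {C : ℝ} (hC0 : 0 ≤ C) (hCζ : ∀ (R₁ R₀ : ℝ), R₁ < R₀ → ∀ t s : ℝ,
      |cutoffProfile R₁ R₀ t - cutoffProfile R₁ R₀ s| ≤ C / (R₀ - R₁) * |t - s|)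
    (ρ : ℕ → ℝ) (hρ : 0 < ρ j)
    (hCl : ∀ b₁ b₂ : PBond P j, |Cloc P j (ρ j / 4) b₁ b₂| ≤ MC * Real.exp (-(δC * (supDist b₁.src b₂.src : ℝ))))
    (x : TSite P 0) (μ lam : Fin P.d) (b'' : PBond P 0) :
    |termKer (P := P) ((P.eta k) ^ P.d) ((P.L : ℝ) ^ k) ρ j ⟨x.shift lam, μ⟩ b'' -
        termKer (P := P) ((P.eta k) ^ P.d) ((P.L : ℝ) ^ k) ρ j ⟨x, μ⟩ b''| ≤
      ((P.L : ℝ) ^ j)⁻¹ * (1 + 16 * C / ρ j) * (M ^ 2 * (MC * ((P.L : ℝ) ^ (k - j)) ^ (P.d - 2)) * (P.d : ℝ) ^ 2 *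
        (Real.exp (min δ δC / 2 / 2) * ((2 * (1 + P.d / (min δ δC / 2))) ^ P.d) ^ 2) *
        Real.exp (-(min δ δC / 2 * ((supDist x b''.src : ℝ) / (P.L : ℝ) ^ j)))) := by
  have hw : 0 < (P.eta k) ^ P.d := pow_pos (eta_pos P k) _
  have hc : (P.L : ℝ) ^ k ≠ 0 := (cast_pow_L_pos' k).ne'
  have hLj : 0 < (P.L : ℝ) ^ j := cast_pow_L_pos' j
  have hM : 0 ≤ M := by
    have h := hH ⟨0, P.hd⟩ ⟨0, P.hd⟩ default default
    exact (mul_nonneg_iff_of_pos_right (Real.exp_pos _)).1 ((abs_nonneg _).trans h)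
  have hR : ρ j / 16 < ρ j / 8 := by linarith
  have hRw : ρ j / 8 - ρ j / 16 = ρ j / 16 := by ring
  have hMC' : 0 ≤ MC * ((P.L : ℝ) ^ (k - j)) ^ (P.d - 2) := mul_nonneg hMC (pow_pos (cast_pow_L_pos' _) _).le
  -- the difference kernel `h`, the plain kernel `h′`, the rescaled `C`
  have hDiff : ∀ (b₀ : PBond P 0) (b₁ : PBond P j),
      |(fun (b₀ : PBond P 0) (b₁ : PBond P j) => hlKer (P := P) ((P.eta k) ^ P.d) ((P.L : ℝ) ^ k) (ρ j / 16) (ρ j / 8) j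
          ⟨b₀.src.shift lam, b₀.dir⟩ b₁ - hlKer (P := P) ((P.eta k) ^ P.d) ((P.L : ℝ) ^ k) (ρ j / 16) (ρ j / 8) j b₀ b₁) b₀ b₁| ≤
        ((P.L : ℝ) ^ j)⁻¹ * (M * (1 + 16 * C / ρ j)) * Real.exp (-(δ * distEU P j b₀.src b₁.src)) := by
    intro b₀ b₁
    have h := abs_hlKer_shift_sub_le hj hw hc ha hH hB hC0 hR (hCζ _ _ hR) b₀.src b₀.dir lam b₁
    rw [hRw] at h
    have e16 : C / (ρ j / 16) = 16 * C / ρ j := by field_simp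
    rw [e16] at h
    exact h
  have h3 := abs_triple_le₂ hj hδ hδC (by positivity : 0 ≤ ((P.L : ℝ) ^ j)⁻¹ * (M * (1 + 16 * C / ρ j))) hM hMC' hDiff
    (abs_hlKer_le_of_sup hj hw hc ha hH (ρ j / 16) (ρ j / 8)) (abs_clKer_ambient_le hd hjk hCl) ⟨x, μ⟩ b''
  rw [termKer_shift_sub_eq_sum]
  refine h3.trans (le_of_eq ?_)
  ring

end

end Literature.MathematicalPhysics.QuantumFieldTheory.BalabanImbrieJaffe1984to88.BIJ88CurlyDkLocGradTerm
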